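import Mathlib
import HarnessLib
import HarnessLib.Audit
import Summits.QuantumFields.Statement
import Summits.QuantumFields.YangMills.Theses.SwapTwistDeficit
import Summits.QuantumFields.YangMills.Theorems.SwapTwistDeficitFlatSheetDefs
import Summits.QuantumFields.YangMills.Theorems.SlowBitWindowInsertionTraceDefs
import Summits.QuantumFields.YangMills.Theorems.QuantileBitPuritySectorDefs
import HarnessLib.Audit.Status.Attr

/-!
Route: ToronSmallBall

# Route ToronSmallBall — Twist-deficit Laplace window from toron core rarity plus an off-core
covariant toron shift

D-0145 LINE g12-A of ideator seat ym-idea-4 (technique card «spectral / trace methods»; this line =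
the trace-door family of g10/g11 continued one layer down by the lens `decomp` on the prover's
landed door). TARGET LEAF BY NAME: `SwapTwistDeficit.TwistDeficitLaplaceWindow` (item
stmt-QuantumFields-23776, the window child W of TwistDeficit 23317; bears_on R2ξ″ via 23776 → 23317
→ K2a `ThermalTraceWindow.SubFemtoFirstLevel` 28291 → K2 28257 → `AllWindowsColdBox.XiSuperPolySU2`
22804, RECORD label). The landed door `twistDeficitLaplaceWindow_of_smallBall` (p681532) reduces W
to ONE thermal small-ball estimate SB(a,γ): on the window L ≤ β^a the zero-flux thermal weight of
the strip {|polDist − polDist∘S| ≤ β^(−γ)} (x- and y-Polyakov holonomies through the origin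
β^(−γ)-close in distance-to-centre) is ≤ β^(−a)/8 · Z_phys(2L), for some 0 < a ≤ 1, γ < 1/2 − 3a. It
suffices to show X = X1 ∧ X2 with X1 = ToronCoreRarity (the collapsed toron CORE {polDist ≤
β^(−γc)}, γc ≤ 3/10, carries thermal weight ≤ β^(−a)) and X2 = OffCoreStripWindow (OFF the core the
strip carries weight ≤ β^(−a), by quasi-invariance of the thermal path measure under the
gauge-covariant global toron shift); the union bound and the door give W. No summit is proved by
this line; it bears on one leaf of one R2ξ″ route.
Lean: `ToronCoreRarity → OffCoreStripWindow →
Summit.QuantumFields.YangMills.Theses.SwapTwistDeficit.TwistDeficitLaplaceWindow`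

## Assembly
Given X1 (γc, a₁) and X2 at that γc (a₀), put a′ = min a₁ a₀ and take γ < 1/2 − 3a′ from X2 at a′;
with a = a′/2 the window L ≤ β^a lies inside both windows (β ≥ 1), the strip is contained in CORE ∪
(STRIP ∩ OFF-CORE) so by monotonicity and additivity of the slice-0 thermal weight
(`TT.insTrace_indicator_zero`, `TT.insTrace_indicator_zero_mono`) its weight is ≤ (β^(−a₁) +
β^(−a′)) Z ≤ β^(−a)/8 · Z for β^(a′/2) ≥ 16, and γ < 1/2 − 3a′ ≤ 1/2 − 3a; the landed door
`Summit.QuantumFields.YangMills.Theorems.SwapTwistDeficit.twistDeficitLaplaceWindow_of_smallBall`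
(p681532) then gives W. Real-exponent bookkeeping plus one union bound; the planner lands it as a
Theorems file against this item.

Rationale: WHY THIS LINE. Mechanism: at weak coupling on the L³ torus the zero-flux thermal state collapses
onto the toron (constant abelian) sector; tree-level Laplace bookkeeping (quartic commutator
potential, RLCT tie 12/4 = 6/2) predicts a log-uniform law for the toron modulus on [β^(−1/4), 1]
(memo bc/g12-dw/memo-SB-toron-collapse.md of prover ym-dw-p1), so the strip mass splits into a CORE
part (both holonomies within β^(−γc) of the centre — the only place where a swap-odd sign witness
can flip cheaply, because the core is nearly S-symmetric) and an OFF-CORE part where the x-holonomy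
axis is well defined and the one-parameter covariant shift U_x(s,first link) ↦ exp(θ Â_x(s)) U_x
moves polDist at unit speed with polynomially small action cost (plaquette changes only through axis
mismatch ∝ plaquette deviation / polDist) and Weyl Jacobian sin²(φ+θ)/sin²φ; k disjoint translates
of the strip then give the 1-dimensional anti-concentration bound. Sources: Luscher1983 §2 (torons,
zero-flux projection), Vanbaal2001 = arXiv:hep-ph/0008206 p.6 (vacuum valley), arXiv:hep-lat/9606014
(zero-momentum modes on the torus), MontvayMunster1994 (3.145) (thermal traces), arXiv:2305.17604
(dimension-explicit Laplace, d³ ≪ β). Imported from probability: Lévy-concentration /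
quasi-invariance (Cameron–Martin-type change of variables along a flow) — new on this problem's
routes, which use trial states, min–max, chessboard/RP or cluster expansions. What it does that
SwapTwistDeficit/SlowBitWindow do not: it names the collapsed toron core as THE obstruction of every
swap-odd sign witness and isolates it in one crux (X1) of RLCT/Laplace type at polynomial (not
Gaussian) precision, leaving the rest (X2) to a soft change-of-variables argument; negatives index:
no refuted statement concerns polDist, insTrace or toron events (checked `ledger negatives --problem
QuantumFields` at filing).

RANKED CRUXES. #2 ToronCoreRarity (crux) — TORON CORE RARITY ON THE WINDOW. There are a core
exponent γc ≤ 3/10, a window exponent a > 0 and thresholds β₀, L₀ such that for all β ≥ β₀ and all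
L₀ ≤ L ≤ β^a the un-normalised zero-flux thermal weight (temperature 1/(2L), torus 2L × L³) of the
slice event {polDist U ≤ β^(−γc)} (x-Polyakov holonomy through the origin within β^(−γc) of the
centre {±1}) is at most β^(−a) · Z_phys(2L). Predicted true for every γc ∈ (1/4 + a, 3/10) by the
log-uniform toron law (mass ≍ β^(1/4−γc)/log β); predicted FALSE for γc < 1/4 (do not lower the
hand-over scale below the quartic scale β^(−1/4)). The hand-over constant 3/10 is not load-bearing:
any value in (1/4, 1/2 − 13a) serves both cruxes. [difficulty: L] (why it might fail: needs the
toron collapse law to polynomial precision UNIFORMLY on L ≤ β^a: the non-constant-mode fluctuation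
integral around flat backgrounds must be flat to a factor β^(o(1)) down to the quartic scale
β^(−1/4), where abelian and non-abelian valleys meet (no clean Gaussian).) [Luscher1983,
Vanbaal2001, arXiv:hep-lat/9606014, arXiv:2305.17604, MontvayMunster1994]
#3 OffCoreStripWindow (crux) — OFF-CORE STRIP ANTI-CONCENTRATION. For every hand-over exponent γc ≤
3/10 there is a₀ ∈ (0,1] such that for every window exponent 0 < a ≤ a₀ there are γ < 1/2 − 3a and
thresholds β₀, L₀ with: for all β ≥ β₀ and L₀ ≤ L ≤ β^a, the zero-flux thermal weight of the slice
event {|polDist U − polDist (S U)| ≤ β^(−γ) and polDist U > β^(−γc)} (S = the x↔y axis swap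
`configPerm (Equiv.swap 0 1)`) is at most β^(−a) · Z_phys(2L). Mechanism: quasi-invariance of the
2L-slice zero-flux path measure under the gauge- and twist-covariant global x-toron shift by angle θ
∈ [β^(−γ), β^(−a)] applied to every slice (density ratio exp(O(θ L⁹ log β · β^γc)) from axis
mismatch, Weyl Jacobian (1 + θβ^γc)^(2L³)), which moves polDist U by ≍ θ and leaves polDist (S U)
fixed; β^a disjoint translates of the strip exhaust an O(1) range. The prover chooses γ (the
narrowest admissible strip is the easiest), so only the loss RATE in a matters: γ ≥ γc + C·a must be
compatible with γ < 1/2 − 3a, i.e. a₀ < (1/2 − γc)/(C + 3). [difficulty: M] (why it might fail: the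
covariant shift changes every plaquette at the shifted links through the mismatch of neighbouring
holonomy axes; if that cost is not polynomial in (L, β^γc, log β) uniformly on the window
(large-field pockets, axis field discontinuous in time), no γ < 1/2 − 3a survives.) [Luscher1983,
Vanbaal2001, MontvayMunster1994, MadrasSokal1988]

TWO-LAYER PLAN. X1 ⇐ (X1a) a fixed-holonomy fluctuation bound: the conditional non-constant-mode
integral F(ρ,u) over flat backgrounds with modulus ρ ∈ [β^(−3/10), 1] varies by at most a factor
β^(o(1)) (one-loop effective potential on the toron torus is O(1) uniformly in L) → (X1b) the
tree-level toron integral restricted to {ρ ≤ β^(−γc)} is ≤ β^(−a) of the whole (explicit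
9-dimensional Laplace with the quartic commutator potential) → X1. X2 ⇐ (X2a) measurable covariant
shift with explicit density on the off-core region → (X2b) translate-counting. Nothing of this is
filed now.

KILL CRITERIA. A proof of ¬ToronCoreRarity for every γc ∈ (1/4, 3/10] (core mass ≥ β^(−o(1)) on some
window sequence — e.g. if the thermal toron law has an atom at the trivial connection of polynomial
weight) closes the route (`--reason refuted:ToronCoreRarity`); then the swap-odd sign-witness family
is dead at W and the seat pivots W to the dimension-explicit Laplace line (O1
`TwistRatioVanishesFixedL` 23802 made uniform) or to a log-scale witness with a core-free door.
¬OffCoreStripWindow at some γc ≤ 3/10 forces a pivot of X2 to a smaller hand-over scale only if X1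
can absorb it; else close. W proved elsewhere (23776 closed) moots the route (`superseded`).

NOT DECOMPOSED YET. The exponents (γc, a, γ) are existential/universal as typed so that no
hand-picked threshold is load-bearing (typing checklist 4c(iv)); the loss constant C of the shift,
the large-field cut, measurability of the shift and the integrability glue are prover-level lemmas
(`--supports`), not items. The fixed-L versions (β → ∞ at fixed L) are rungs, not items: X1 at fixed
L is an honest 54L⁴-dimensional Laplace statement and is the BC5 plan-only rung.

CHEAPEST FALSIFIER. INSTRUMENT ROW (kit, MC; refutes/calibrates X1 and X2 at once): SU(2) heat-bath
on 2L × L³ with the zero-flux/twist-averaged seam exactly as in the g11 jobs (j320281 family), L ∈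
{2, 3}, β ∈ {8, 16, 32, 64}; record the slice histogram of log polDist, the core masses m_c(γc) =
P(polDist ≤ β^(−γc)) for γc ∈ {0.25, 0.275, 0.30} and the off-core strip masses m_s(γ, γc) =
P(|polDist − polDist∘S| ≤ β^(−γ), polDist > β^(−γc)) for γ ∈ {0.35, 0.40, 0.45}. Predictions
(log-uniform law): m_c(0.30) decreasing in β roughly like β^(−0.05)/log β (slow! the decisive check
is the SHAPE of the log polDist histogram: flat density on [−(1/4) log β, 0] with an edge at −(1/4)
log β); m_s(0.45, 0.30) ≍ β^(−0.15). KILL: a log-histogram whose mass below −(1/4)log β does not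
shrink between β = 16 and β = 64 at both L (an atom at the trivial connection) kills X1 as typed;
m_s not decreasing in β at fixed (γ, γc) kills X2. Job id and pre-registered numbers are posted on
the seat's HOME INBOX before the run (P-I1 discipline of critic idea-crit-4).

NUMBERS. Quartic (commutator) scale of the toron modulus: β^(−1/4); kinetic one-step scale: β^(−1/2)
(door constraint γ < 1/2 − 3a from `TT.stripWidth_le_rpow`); log-uniform heuristic P(polDist ≤
β^(−γc)) ≈ (β^(1/4−γc))/((1/4) log β) for γc > 1/4, ≈ 1 − 4γc for γc < 1/4
(memo-SB-toron-collapse.md §1, prover ym-dw-p1 g12); admissible triples exist iff 1/4 + a < γc and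
γc + C a < 1/2 − 3a, e.g. (a, γc, γ) = (1/100, 0.29, 0.45) for any loss constant C ≤ 13.

DEFINITION REQUESTS. None: every object is in tree (`TT.insTrace` p661692, `FlatSheet.polDist`
SwapTwistDeficitFlatSheetDefs, `configPerm`, `TT.physTrace`).

Novelty: Searches (2026-08-29): lit search --hybrid "toron constant gauge field modes small volume effective
measure vacuum valley lattice SU(2)" (8 docs: [corpus:book:montvay1994-quantum-fields-lattice
pp.328,307], [corpus:book:greensite2011-introduction-confinement-problem pp.173-184]); lit search
--hybrid "distribution of Polyakov loop eigenvalues small volume perturbative femto universe" (8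
docs, nearest [corpus:book:greensite2011 pp.76-77,121]); lit search "toron zero-momentum Jacobian"
([corpus:paper:arxiv-hep-ph_0008206 p.6] van Baal vacuum/toron valley;
[corpus:paper:arxiv-hep-lat_9606014 p.2] zero-momentum modes and masses on a torus;
[corpus:paper:arxiv-1611.07205 p.2]); lit galaxy search "vacuum valley|toron|zero-momentum modes"
--star all (30 rows, all substring noise «Toronto»: no hits); lit galaxy search
"quasi-invariance|quasi-invariant measure|Polyakov loop distribution" --star all (16 rows, LNM
proceedings only, nothing on lattice gauge measures: no hits); ledger negatives --problem
QuantumFields (no polDist / insTrace statement). OpenAlex/S2 in HTTP-429 cool-down (not dialled).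
Nearest prior art found: Vanbaal2001 (arXiv:hep-ph/0008206, vacuum valley and the non-adiabatic
toron effective Hamiltonian) and arXiv:hep-lat/9606014 (zero-momentum modes on the torus,
perturbative treatment): both compute WITH the toron sector semiclassically; neither proves a
measure-level rarity/anti-concentration bound for the thermal holonomy law, and no listed route
(SwapTwistDeficit, S  [refs: hep-ph/0008206, hep-lat/9606014, book:montvay1994-quantum-fields-lattice, book:greensite2011-introduction-confinement-problem, book:greensite2011, paper:arxiv-hep-ph_0008206, paper:arxiv-hep-lat_9606014, paper:arxiv-1611.07205, Vanbaal2001]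

Barriers (technique_class: quasi-invariance, anti-concentration, laplace, trace): - technique_class: quasi-invariance, anti-concentration, laplace, trace
- Literature.Barriers.QuantumFields.PerturbativeInvisibility: outside — both cruxes are
finite-lattice thermal-weight inequalities at polynomial precision inside the sub-femto window L ≤
β^a; no quantity in physical units, no continuum or infinite-volume limit is asserted (the barrier
quantifies over perturbative series for am(g)).
- Literature.Barriers.QuantumFields.ToronPlaneAnticorrelation: outside — no product-closed
positive-association criterion (FKG/Holley/MTP₂) is invoked; the anti-concentration is a change of
variables along a flow, valid sign-indefinitely.
- Literature.Barriers.QuantumFields.EguchiKawaiBreakdown: outside — the line never reduces to the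
one-site model; it works on the full (ℤ/L)³ torus and uses the toron sector only as the region where
the measure concentrates.
- Literature.Barriers.QuantumFields.FiniteTemperatureDeconfinement: outside — aspect ratio fixed (2L
× L³) with L ≤ β^a; no fixed-N_t thermodynamic limit, no centre-symmetry order parameter is claimed
to vanish or not.
- Literature.Barriers.QuantumFields.UVStabilityNonUniqueness: outside — no continuum limit is taken;
the bet is that polynomial-precision statements on the window need only one-loop control around flat
connections, not Bałaban's full multiscale expansion (this is exactly the why-might-fail of
ToronCoreRarity).
- Negatives index: empty for polDist/insTrace/toron statements at filing; the refuted QuantumFields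

sub-problem: YangMills · status: draft · opened planner-ym-idea-4-g12-0 2026-08-29T00:43:40Z · rev 4 · ledger route-QuantumFields-ToronSmallBall
GENERATED by the gate from the ledger (D-0016/17). Provers cite these decls: `theorem foo : Summit.QuantumFields.YangMills.Theses.ToronSmallBall.<Decl> := …` in Summits/QuantumFields/YangMills/Theorems/<Name>.lean.
-/

namespace Summit.QuantumFields.YangMills.Theses.ToronSmallBall

open scoped BigOperators Topology Manifold Classical MeasureTheory ProbabilityTheory Matrix InnerProductSpace ComplexConjugate ContinuousMap
open Filter Set Function TopologicalSpace MeasureTheory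

attribute [summit_statement] _root_.YangMills

/-- item stmt-QuantumFields-23956 · crux · rank 2 · closed · proved by Summit.QuantumFields.YangMills.Theorems.ToronSmallBall.toronCoreRaritySubQuartic_proof (prover) · by planner
why it might fail: translate cost: sup-norm factors TL⁴ of the 2K sheet shifts must stay below β^(1/2−2γc) (rate 0.15 − 2.5a at γc = 2/5), and the two-axis case split (tree-transported fixed axis when all holonomies ≤ β^(-1/4+ε') vs fattest-holonomy axis) must cover the whole good-field event
sources: bc/g12-B/PLAN-X1-translates.md, MC j321877/j321999/j322003 H-core (ratio 0.74–0.81 at γc = 0.40)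
[crux] X1' sub-quartic toron core rarity (cap 2/5; WEAKER than ToronCoreRarity ⟨23898⟩): for some γc
≤ 2/5 the slice-0 thermal weight of {polDist ≤ β^-γc} on the 2L-ring is ≤ β^-a·Z for L ≤ β^a;
translate-provable below the quartic scale (2K disjoint ± sheet-translates, tree-transported /
fattest-holonomy axis, rate γc−1/4−2.5a, no one-loop input: bc/g12-B/PLAN-X1-translates.md); MC
j321877/j322003: m_c(γc) ratio β 16→64 = 1.08, 0.94, 0.81, 0.67, 0.56 at γc = .30,.35,.40,.45,.50
(6×3³) — the registered cap-3/10 statistic does not shrink at accessible β (kill-zone of the frozen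
rule), the cap-2/5 one does; why it might fail: sup-norm cost factors TL⁴ of the sheet shift must
stay below β^(1/2−2γc) and the two-axis case split must cover the good-field event; sources:
PLAN-X1-translates.md, bc/g12-dw/PLAN-SB.md, vanbaal2001 -/
@[route_item "route-QuantumFields-ToronSmallBall", crux]
def ToronCoreRaritySubQuartic : Prop :=
  ∃ γc : ℝ, γc ≤ 2 / 5 ∧ ∃ a : ℝ, 0 < a ∧ ∃ β₀ : ℝ, ∃ L₀ : ℕ, ∀ β : ℝ, β₀ ≤ β → ∀ (L : ℕ) [NeZero L], L₀ ≤ L → (L : ℝ) ≤ β ^ a → Summit.QuantumFields.YangMills.Theorems.FemtoTransferGap.TT.insTrace L β (Set.indicator {U : Literature.MathematicalPhysics.QuantumFieldTheory.GaugeConfig 3 L Summit.QuantumFields.YangMills.Theorems.FemtoTransferGap.SU2 | Summit.QuantumFields.YangMills.Theorems.FemtoTransferGap.FlatSheet.polDist U ≤ β ^ (-γc)} fun _ => (1 : ℝ)) 0 ≤ β ^ (-a) * Summit.QuantumFields.YangMills.Theorems.FemtoTransferGap.TT.physTrace L β (2 * L)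

-- `ToronCoreRaritySubQuartic` holds: proved by `Summit.QuantumFields.YangMills.Theorems.ToronSmallBall.toronCoreRaritySubQuartic_proof` (its module imports this route file, so no `_holds` link can be stated here).

/-- item stmt-QuantumFields-23957 · crux · rank 3 · closed · proved by Summit.QuantumFields.YangMills.Theorems.ToronSmallBall.offCoreStripWindowDeep_proof (prover) · by planner
why it might fail: strip centres c in [β^-2/5, β^-1/4] sit inside the non-commuting quartic core: the odd first-order cost of the covariant toron shift (sup-norm ~ β^(1/4+a−γ)·TL²) must cancel exactly under ± pairing, and the bookkeeping needs γ ≥ γc + 10a with γ < 1/2 − 3a (a < 1/130 at cap 2/5)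
sources: bc/g12-dw/PLAN-SB.md, bc/g12-B/PLAN-X1-translates.md, vanbaal2001, MC j321999/j322003 deep strips
[crux] X2' deep off-core strip anti-concentration (every cap γc ≤ 2/5; STRONGER than
OffCoreStripWindow ⟨23899⟩ — implies it): slice-0 thermal weight of {|polDist − polDist∘swap| ≤ β^-γ
∧ polDist > β^-γc} ≤ β^-a·Z, some γ < 1/2 − 3a, L ≤ β^a; same covariant x-toron shift plan (PLAN-SB
S1) with ρ₁ down to β^-2/5 (axis conditioning Lβ^(−1/2+ε)/ρ ≤ β^(a+ε−1/10)); MC j321999/j322003: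
deep strips m_s(0.48|0.40), m_s(0.50|0.45) ratio 16→64 = 0.73/0.71 (6×3³), 0.74/0.72 (4×2³) vs
registered 0.73/0.71 — supported; why it might fail: the odd first-order shift cost inside the
quartic core (c ∈ [β^-2/5, β^-1/4]) must cancel exactly under ± pairing and the strip bookkeeping
needs γ ≥ γc + 10a with γ < 1/2 − 3a (a < 1/130); sources: bc/g12-dw/PLAN-SB.md,
PLAN-X1-translates.md, vanbaal2001 -/
@[route_item "route-QuantumFields-ToronSmallBall", crux]
def OffCoreStripWindowDeep : Prop :=
  ∀ γc : ℝ, γc ≤ 2 / 5 → ∃ a₀ : ℝ, 0 < a₀ ∧ a₀ ≤ 1 ∧ ∀ a : ℝ, 0 < a → a ≤ a₀ → ∃ γ : ℝ, γ < 1 / 2 - 3 * a ∧ ∃ β₀ : ℝ, ∃ L₀ : ℕ, ∀ β : ℝ, β₀ ≤ β → ∀ (L : ℕ) [NeZero L], L₀ ≤ L → (L : ℝ) ≤ β ^ a → Summit.QuantumFields.YangMills.Theorems.FemtoTransferGap.TT.insTrace L β (Set.indicator {U : Literature.MathematicalPhysics.QuantumFieldTheory.GaugeConfig 3 L Summit.QuantumFields.YangMills.Theorems.FemtoTransferGap.SU2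 | |Summit.QuantumFields.YangMills.Theorems.FemtoTransferGap.FlatSheet.polDist U - Summit.QuantumFields.YangMills.Theorems.FemtoTransferGap.FlatSheet.polDist (Literature.MathematicalPhysics.QuantumFieldTheory.configPerm (Equiv.swap (0 : Fin 3) 1) U)| ≤ β ^ (-γ) ∧ β ^ (-γc) < Summit.QuantumFields.YangMills.Theorems.FemtoTransferGap.FlatSheet.polDist U} fun _ => (1 : ℝ)) 0 ≤ β ^ (-a) * Summit.QuantumFields.YangMills.Theorems.FemtoTransferGap.TT.physTrace L β (2 * L)

-- `OffCoreStripWindowDeep` holds: proved by `Summit.QuantumFields.YangMills.Theorems.ToronSmallBall.offCoreStripWindowDeep_proof` (its module imports this route file, so no `_holds` link can be stated here).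

-- parent: OffCoreStripWindowDeep · child (gen 1)
/--     item stmt-QuantumFields-24079 · crux · rank 301 · closed · proved by Summit.QuantumFields.YangMills.Theorems.FluxSectorLaplace.fluxSectorSuppression_proof (prover)
    parent: OffCoreStripWindowDeep · by planner
    why it might fail: L-uniformity: Laplace constants (near-flat lattice strata, determinant ratios, two-loop remainders ∝ g²·polylog L) must stay bounded for L ≤ β^a; a hidden e^(cL³) in the Gaussian comparison beats β^(−a) unless a sits below the d³ ≪ β threshold.
    sources: Thooft1979, GonzalezarroyoAltes1988, Luscher1983, KollerVanbaal1986, arXiv:2305.17604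
[crux] ELECTRIC-FLUX SECTOR SUPPRESSION on the Laplace window: there are a > 0, β₀, L₀ such that for
β ≥ β₀, L₀ ≤ L ≤ β^a and every seam twist z ≠ 0 the sector weight `TT.sectorWeight β (2L−1) z 1`
(the z-twisted 2L-slice partition function Tr(T_z P_G 𝕂^(2L))) is ≤ β^(−a)·`TT.physTrace L β (2L)`.
Fixed-L prediction W_z/Z ≍ β^(−3/2)/log β (rigid twisted flat connections versus toron zero modes);
the crux asks only for SOME uniform power on the window. [difficulty: L] -/
@[route_item "route-QuantumFields-ToronSmallBall"]
def FluxSectorSuppression : Prop :=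
  ∃ a : ℝ, 0 < a ∧ ∃ β₀ : ℝ, ∃ L₀ : ℕ, ∀ β : ℝ, β₀ ≤ β → ∀ (L : ℕ) [NeZero L], L₀ ≤ L → (L : ℝ) ≤ β ^ a → ∀ z : Fin 3 → Bool, z ≠ (fun _ => false) → Summit.QuantumFields.YangMills.Theorems.FemtoTransferGap.TT.sectorWeight (L := L) β (2 * L - 1) z (fun _ _ => (1 : ℝ)) ≤ β ^ (-a) * Summit.QuantumFields.YangMills.Theorems.FemtoTransferGap.TT.physTrace L β (2 * L)

-- `FluxSectorSuppression` holds: proved by `Summit.QuantumFields.YangMills.Theorems.FluxSectorLaplace.fluxSectorSuppression_proof` (its module imports this route file, so no `_holds` link can be stated here).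

-- parent: OffCoreStripWindowDeep · child (gen 1)
/--     item stmt-QuantumFields-24089 · crux · rank 302 · closed · proved by Summit.QuantumFields.YangMills.Theorems.ToronSmallBall.periodicOffCoreStripWindowDeep_proof (prover)
    parent: OffCoreStripWindowDeep · by planner
    why it might fail: the own-axis translate by β^(−γ) must stay Gaussian uniformly in L ≤ β^a off the core; if the strip's sector-0 mass sits on configurations fat only along the swapped pair, the translate gains no factor β^(−a).
    sources: Luscher1983, Vanbaal2001, KollerVanbaal1986, arXiv:hep-lat/9606014, arXiv:2305.17604
[crux; periodic-sector half of OffCoreStripWindowDeep ⟨23957⟩ per idea-crit-4 ruling (ii)] in the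
untwisted seam sector z = 0 the slice-0 event {swap-strip |polDist U − polDist (swap₀₁ U)| ≤ β^(−γ)}
∩ {off-core polDist U > β^(−γc)} has sector weight ≤ β^(−a)·Z_phys(2L) on the window, with the same
quantifier shape as ⟨23957⟩ (∀ γc ≤ 2/5, ∃ a₀, ∀ a ≤ a₀, ∃ γ < 1/2 − 3a). Engine: PLAN-X1 v2
one-case own-axis sheet translate inside sector 0 (no seam sign defect). -/
@[route_item "route-QuantumFields-ToronSmallBall"]
def PeriodicOffCoreStripWindowDeep : Prop :=
  ∀ γc : ℝ, γc ≤ 2 / 5 → ∃ a₀ : ℝ, 0 < a₀ ∧ a₀ ≤ 1 ∧ ∀ a : ℝ, 0 < a → a ≤ a₀ → ∃ γ : ℝ, γ < 1 / 2 - 3 * a ∧ ∃ β₀ : ℝ, ∃ L₀ : ℕ, ∀ β : ℝ, β₀ ≤ β → ∀ (L : ℕ) [NeZero L], L₀ ≤ L → (L : ℝ) ≤ β ^ a → Summit.QuantumFields.YangMills.Theorems.FemtoTransferGap.TT.sectorWeight (L := L) β (2 * L - 1) (fun _ => false) (fun Us _ => Set.indicator {U : Literature.MathematicalPhysics.QuantumFieldTheory.GaugeConfig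 3 L Summit.QuantumFields.YangMills.Theorems.FemtoTransferGap.SU2 | |Summit.QuantumFields.YangMills.Theorems.FemtoTransferGap.FlatSheet.polDist U - Summit.QuantumFields.YangMills.Theorems.FemtoTransferGap.FlatSheet.polDist (Literature.MathematicalPhysics.QuantumFieldTheory.configPerm (Equiv.swap (0 : Fin 3) 1) U)| ≤ β ^ (-γ) ∧ β ^ (-γc) < Summit.QuantumFields.YangMills.Theorems.FemtoTransferGap.FlatSheet.polDist U} (fun _ => (1 : ℝ)) (Us 0)) ≤ β ^ (-a) * Summit.QuantumFields.YangMills.Theorems.FemtoTransferGap.TT.physTrace L β (2 * L)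

-- `PeriodicOffCoreStripWindowDeep` holds: proved by `Summit.QuantumFields.YangMills.Theorems.ToronSmallBall.periodicOffCoreStripWindowDeep_proof` (its module imports this route file, so no `_holds` link can be stated here).

-- parent: OffCoreStripWindowDeep · glue (gen 1)
/--     item stmt-QuantumFields-24090 · support · rank 303 · closed · proved by Summit.QuantumFields.YangMills.Theorems.ToronSmallBall.toronSmallBall_offCoreStripWindowDeepGlue_proof (prover)
    parent: OffCoreStripWindowDeep · GLUE: children ⟹ parent · by planner
eight-sector decomposition insTrace(1_A) = (1/8) sum_z W_z(1_A(U_0))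
(FluxSectorLaplace.SectorDecomposition 24081 + SectorWeightMonotone 24082, being landed by
ym-dw-p1): z ≠ 0 terms via FluxSectorSuppression (rate beta^(-a1), take a0 := min(a0', a1)), z = 0
term via PeriodicOffCoreStripWindowDeep; A = strip ∩ off-core is measurable (polDist, configPerm
measurable). -/
@[route_item "route-QuantumFields-ToronSmallBall"]
def OffCoreStripWindowDeepGlue : Prop :=
  FluxSectorSuppression → PeriodicOffCoreStripWindowDeep → OffCoreStripWindowDeep

-- `OffCoreStripWindowDeepGlue` holds: proved by `Summit.QuantumFields.YangMills.Theorems.ToronSmallBall.toronSmallBall_offCoreStripWindowDeepGlue_proof` (its module imports this route file, so no `_holds` link can be stated here).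

/-- item stmt-QuantumFields-23898 · aside · rank 2 · open · by planner
why it might fail: needs the toron collapse law to polynomial precision UNIFORMLY on L ≤ β^a: the non-constant-mode fluctuation integral around flat backgrounds must be flat to a factor β^(o(1)) down to the quartic scale β^(−1/4), where abelian and non-abelian valleys meet (no clean Gaussian).
sources: Luscher1983, Vanbaal2001, arXiv:hep-lat/9606014, arXiv:2305.17604, MontvayMunster1994
[crux] TORON CORE RARITY ON THE WINDOW. There are a core exponent γc ≤ 3/10, a window exponent a > 0
and thresholds β₀, L₀ such that for all β ≥ β₀ and all L₀ ≤ L ≤ β^a the un-normalised zero-flux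
thermal weight (temperature 1/(2L), torus 2L × L³) of the slice event {polDist U ≤ β^(−γc)}
(x-Polyakov holonomy through the origin within β^(−γc) of the centre {±1}) is at most β^(−a) ·
Z_phys(2L). Predicted true for every γc ∈ (1/4 + a, 3/10) by the log-uniform toron law (mass ≍
β^(1/4−γc)/log β); predicted FALSE for γc < 1/4 (do not lower the hand-over scale below the quartic
scale β^(−1/4)). The hand-over constant 3/10 is not load-bearing: any value in (1/4, 1/2 − 13a)
serves both cruxes. [difficulty: L] -/
@[route_item "route-QuantumFields-ToronSmallBall", crux]
def ToronCoreRarity : Prop :=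
  ∃ γc : ℝ, γc ≤ 3 / 10 ∧ ∃ a : ℝ, 0 < a ∧ ∃ β₀ : ℝ, ∃ L₀ : ℕ, ∀ β : ℝ, β₀ ≤ β → ∀ (L : ℕ) [NeZero L], L₀ ≤ L → (L : ℝ) ≤ β ^ a → Summit.QuantumFields.YangMills.Theorems.FemtoTransferGap.TT.insTrace L β (Set.indicator {U : Literature.MathematicalPhysics.QuantumFieldTheory.GaugeConfig 3 L Summit.QuantumFields.YangMills.Theorems.FemtoTransferGap.SU2 | Summit.QuantumFields.YangMills.Theorems.FemtoTransferGap.FlatSheet.polDist U ≤ β ^ (-γc)} fun _ => (1 : ℝ)) 0 ≤ β ^ (-a) * Summit.QuantumFields.YangMills.Theorems.FemtoTransferGap.TT.physTrace L β (2 * L)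

/-- item stmt-QuantumFields-23899 · aside · rank 3 · closed · proved by Summit.QuantumFields.YangMills.Theorems.ToronSmallBall.offCoreStripWindow_proof (prover) · by planner
why it might fail: the covariant shift changes every plaquette at the shifted links through the mismatch of neighbouring holonomy axes; if that cost is not polynomial in (L, β^γc, log β) uniformly on the window (large-field pockets, axis field discontinuous in time), no γ < 1/2 − 3a survives.
sources: Luscher1983, Vanbaal2001, MontvayMunster1994, MadrasSokal1988
[crux] OFF-CORE STRIP ANTI-CONCENTRATION. For every hand-over exponent γc ≤ 3/10 there is a₀ ∈ (0,1]
such that for every window exponent 0 < a ≤ a₀ there are γ < 1/2 − 3a and thresholds β₀, L₀ with: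
for all β ≥ β₀ and L₀ ≤ L ≤ β^a, the zero-flux thermal weight of the slice event {|polDist U −
polDist (S U)| ≤ β^(−γ) and polDist U > β^(−γc)} (S = the x↔y axis swap `configPerm (Equiv.swap 0
1)`) is at most β^(−a) · Z_phys(2L). Mechanism: quasi-invariance of the 2L-slice zero-flux path
measure under the gauge- and twist-covariant global x-toron shift by angle θ ∈ [β^(−γ), β^(−a)]
applied to every slice (density ratio exp(O(θ L⁹ log β · β^γc)) from axis mismatch, Weyl Jacobian (1
+ θβ^γc)^(2L³)), which moves polDist U by ≍ θ and leaves polDist (S U) fixed; β^a disjoint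
translates of the strip exhaust an O(1) range. The prover chooses γ (the narrowest admissible strip
is the easiest), so only the loss RATE in a matters: γ ≥ γc + C·a must be compatible with γ < 1/2 −
3a, i.e. a₀ < (1/2 − γc)/(C + 3). [difficulty: M] -/
@[route_item "route-QuantumFields-ToronSmallBall"]
def OffCoreStripWindow : Prop :=
  ∀ γc : ℝ, γc ≤ 3 / 10 → ∃ a₀ : ℝ, 0 < a₀ ∧ a₀ ≤ 1 ∧ ∀ a : ℝ, 0 < a → a ≤ a₀ → ∃ γ : ℝ, γ < 1 / 2 - 3 * a ∧ ∃ β₀ : ℝ, ∃ L₀ : ℕ, ∀ β : ℝ, β₀ ≤ β → ∀ (L : ℕ) [NeZero L], L₀ ≤ L → (L : ℝ) ≤ β ^ a → Summit.QuantumFields.YangMills.Theorems.FemtoTransferGap.TT.insTrace L β (Set.indicator {U : Literature.MathematicalPhysics.QuantumFieldTheory.GaugeConfig 3 L Summit.QuantumFields.YangMills.Theorems.FemtoTransferGap.SU2 | |Summit.QuantumFields.YangMills.Theorems.FemtoTransferGap.FlatSheet.polDist U - Summit.QuantumFields.YangMills.Theorems.FemtoTransferGap.FlatSheet.polDist (Literature.MathematicalPhysics.QuantumFieldTheory.configPerm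 (Equiv.swap (0 : Fin 3) 1) U)| ≤ β ^ (-γ) ∧ β ^ (-γc) < Summit.QuantumFields.YangMills.Theorems.FemtoTransferGap.FlatSheet.polDist U} fun _ => (1 : ℝ)) 0 ≤ β ^ (-a) * Summit.QuantumFields.YangMills.Theorems.FemtoTransferGap.TT.physTrace L β (2 * L)

-- `OffCoreStripWindow` holds: proved by `Summit.QuantumFields.YangMills.Theorems.ToronSmallBall.offCoreStripWindow_proof` (its module imports this route file, so no `_holds` link can be stated here).

/-- item stmt-QuantumFields-23900 · assembly · rank 1 · closed · proved by Summit.QuantumFields.YangMills.Theorems.ToronSmallBall.assembly_proof (prover) · by planner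
sources: MontvayMunster1994, Luscher1983
[assembly] ToronCoreRarity → OffCoreStripWindow → TwistDeficitLaplaceWindow (union bound + parameter
bookkeeping + the landed small-ball door p681532). Provable now; proof in hand modulo routine
integrability of the chain times an indicator (pattern of `TT.insTrace_indicator_zero_mono`). -/
@[route_item "route-QuantumFields-ToronSmallBall"]
def Assembly : Prop :=
  ToronCoreRarity → OffCoreStripWindow → Summit.QuantumFields.YangMills.Theses.SwapTwistDeficit.TwistDeficitLaplaceWindow

-- `Assembly` holds: proved by `Summit.QuantumFields.YangMills.Theorems.ToronSmallBall.assembly_proof` (its module imports this route file, so no `_holds` link can be stated here).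

/-- item stmt-QuantumFields-23958 · assembly · rank 9 · closed · proved by Summit.QuantumFields.YangMills.Theorems.ToronSmallBall.assemblyDeep_proof (planner) · by planner
[support] Assembly' for the deep pair: same union-bound + exponent bookkeeping + door
twistDeficitLaplaceWindow_of_smallBall as ToronSmallBall.Assembly ⟨23900⟩ (proof p683812 is
cap-generic); planner lands the proof (Theorems/ToronSmallBallAssemblyDeep.lean); sources:
Theorems/ToronSmallBallAssembly.lean -/
@[route_item "route-QuantumFields-ToronSmallBall", crux]
def Assembly2 : Prop :=
  ToronCoreRaritySubQuartic → OffCoreStripWindowDeep → Summit.QuantumFields.YangMills.Theses.SwapTwistDeficit.TwistDeficitLaplaceWindow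

-- `Assembly2` holds: proved by `Summit.QuantumFields.YangMills.Theorems.ToronSmallBall.assemblyDeep_proof` (its module imports this route file, so no `_holds` link can be stated here).

/-! D-0027 §2.1 — DECIDING THEOREM (planner-authored via `route open/edit --closes-file`; by planner-ym-idea-4-g12-0 2026-08-29T01:38:40Z):
its hypotheses are this route's items and its conclusion the sub-problem Statement (glue_lint), and it elaborates with this file. -/

@[closes "route-QuantumFields-ToronSmallBall"] theorem closes (h₁ : ToronCoreRaritySubQuartic) (h₂ : OffCoreStripWindowDeep) (hA : Assembly2) :
    Summit.QuantumFields.YangMills.Theses.SwapTwistDeficit.TwistDeficitLaplaceWindow :=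
  hA h₁ h₂

end Summit.QuantumFields.YangMills.Theses.ToronSmallBall
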